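import Summits.ValiantsHypothesis.ValiantsHypothesis.Theorems.GrenetZeonDualUnipotentThreeHalvesSlowCoreLedger

/-!
# RESOLVENT FLAGS for crux 24318 (c) `LongMassSlowLawInv` / HWL — providers and their PROOF (row r8, part 1/2; val-idea-30 g6/g7, ported by name)

# RESOLVENT FLAGS for crux 24318 (c) `LongMassSlowLawInv` / HWL — providers, (rev 2) their PROOF, (rev 3) the EXACT dictionary

val-idea-30 g6 (signatures, dictionary) · g7 (§P: kernel proof of both providers; §Q: `Ledger ⟺ one congruence`, exact).  Crux workfile of the idea
`Ideas/resolvent-flag.md` (memo `MEMO-idea30-g6-resolvent-flag.md`), stated over the landed Theorems twins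
✓ `SlowCore.Ledger` / `SlowCore.linEntry` / `SlowCore.RelCert` (file `…SlowCoreLedger.lean`).
VP ≠ VNP is NOT proved; 24318 / S3 / R2ᵖ / (c) are OPEN.  What IS proved here (rev 2, 0 sorries, axioms standard):
`ledgerOfResolventIndex_holds : LedgerOfResolventIndex`, `ledgerOfResolventFlag_holds : LedgerOfResolventFlag`,
and the pluggable form `relCert_of_twist_pow_eq_zero` (a resolvent-index certificate `(K, k)` is a `RelCert` of price
`n·k + codim K`) — i.e. every resolvent-flag / resolvent-index computation of the (c)-programme is a kernel `Ledger`.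
REV 3 (§Q, 0 sorries): the identity `[s^d](A+sB)^b = [u^{b-d}](T^d R_A)` for ALL `b, d` with NO hypothesis on the twist
(`pow_lineSubst_apply_eq_sum`, `coeff_pow_lineSubst_apply`), hence the EXACT instrument
`ledger_top_iff_twist_pow_congr : Ledger n m N ⊤ K k ↔ ∀ x, ∀ v ∈ K, (twist N x v)^(k+1) ≡ 0 mod u^(n-1-k)` (coefficientwise),
and the congruence certificate `relCert_of_twist_pow_congr` (strictly more certificates than exact vanishing when `(k+1)(m-1) > n-2-k`).

Dictionary (memo §1): with `A := N(x)`, `B_v := lin v`, `R_A(u) := Σ_{a<m} u^a A^a = (1 - uA)⁻¹` (A^m = 0),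
  `Σ_j u^j (A + sB)^j = Σ_d (us)^d (R_A B)^d R_A`,  so  `[s^d](A+sB)^j = [u^{j-d}] (R_A B)^d R_A`,
hence `Ledger_n(K,k)` at `x`  ⟺  `∀ v ∈ K, (R_A(u) B_v)^{k+1} ≡ 0 mod u^{n-1-k}`; in particular the EXACT identity
`(R_A(u) B_v)^{k+1} = 0` in `M_m(ℂ[u])` gives the ledger for every `n` (provider `LedgerOfResolventIndex`, ✓ §P), and an
`F(u)`-flag lowered by the twisted space `R_A(u)·lin K` (all `(k+1)`-fold products vanish) gives it a fortiori
(provider `LedgerOfResolventFlag`, ✓ §P).  The proof in §P is a finite polynomial identity over `ℂ[s][u]`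
(`1 − u(A+sB) = (1 − uA)(1 − us·R_A B)` + two geometric sums + comparison of `u^b`-coefficients); no power series.

Port (val-lit-p3 g18, desk #399) of val-idea-30 g7's `Cruxes/DualUnipotentThreeHalves/ResolventFlag.lean` REV 3 (tree sha16 c47d387411ee7036, 472 l.,
farm rc 0/0/0/0, axioms std; critic of record val-idea-crit-7 g3 V36/V44: «the exact dictionary is CORRECT») — decl bodies VERBATIM by name, namespace
`…Cruxes.DualUnipotentThreeHalves.ResolventFlag` → `…Theorems.GrenetZeon.ResolventFlag`, split in two at the §P/§Q seam for the 400-line convention (the §P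
helpers that §Q uses lose `private`, visibility only).  ROW r8 of crit-7's (c) class table: an INSTRUMENT / support row — every resolvent-flag / resolvent-index
computation of the (c)-programme is a kernel `SlowCore.Ledger`; never an `IrreducibleInv` constituent; NOT progress on (c) `LongMassSlowLawInv` (RESEARCH — OPEN);
24318 / S3 / R2ᵖ OPEN; VP ≠ VNP is NOT proved.  Helper (`--supports stmt-ValiantsHypothesis-24318 --as helper`).  Credit: mathematics and kernel proofs
val-idea-30 g6/g7; vocabulary val-idea-26 g5 / val-port-2 g3 (✓ `…SlowCoreLedger`).  No instances, no notation, no named facts.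
-/

set_option linter.dupNamespace false

namespace Summit.ValiantsHypothesis.ValiantsHypothesis.Theorems.GrenetZeon.ResolventFlag

open MvPolynomial Matrix
open scoped BigOperators Polynomial
open Summit.ValiantsHypothesis.ValiantsHypothesis.Cruxes.TwoDimCoefficients.DimTwoCases (AffMat IsAffine)
open Summit.ValiantsHypothesis.ValiantsHypothesis.Theorems.GrenetZeon.SlowCore (linEntry Ledger RelCert)

/-- The value `N(x) ∈ M_m(ℂ)` of the pencil at the point `x`. -/
noncomputable def pointMat {n m : ℕ} (N : AffMat n m) (x : Fin n × Fin n → ℂ) : Matrix (Fin m) (Fin m) ℂ :=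
  N.map (MvPolynomial.eval x)

/-- The linear part of the pencil along the direction `v`: `(lin v)_{ij} = linEntry N i j v`. -/
noncomputable def linMat {n m : ℕ} (N : AffMat n m) (v : Fin n × Fin n → ℂ) : Matrix (Fin m) (Fin m) ℂ :=
  Matrix.of fun i j => linEntry N i j v

/-- The (truncated) RESOLVENT `R_A(u) = Σ_{a<m} u^a A^a ∈ M_m(ℂ[u])` of `A = N(x)`; equals `(1 - u A)⁻¹` when `A^m = 0`. -/
noncomputable def resolvent {n m : ℕ} (N : AffMat n m) (x : Fin n × Fin n → ℂ) : Matrix (Fin m) (Fin m) ℂ[X] :=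
  ∑ a ∈ Finset.range m, (Polynomial.X : ℂ[X]) ^ a • ((pointMat N x) ^ a).map Polynomial.C

/-- The TWIST of the direction `v` at the point `x`: `R_{N(x)}(u) · lin v ∈ M_m(ℂ[u])`. -/
noncomputable def twist {n m : ℕ} (N : AffMat n m) (x v : Fin n × Fin n → ℂ) : Matrix (Fin m) (Fin m) ℂ[X] :=
  resolvent N x * (linMat N v).map Polynomial.C

/-- **FIRST LEMMA (provider, index form).**  If at every point `x` every twisted direction `R_{N(x)}(u)·lin v` (`v ∈ K`) is
nilpotent of index `≤ k+1` as a matrix over `ℂ[u]`, then `(K, k)` is a whole-pencil ledger of `N` for EVERY `n`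
(no truncation loss).  Paper proof: the resolvent identity `[s^d](A+sB)^b = [u^{b-d}](R_A B)^d R_A`. -/
def LedgerOfResolventIndex : Prop :=
  ∀ (n m : ℕ) (N : AffMat n m), IsAffine N → N ^ m = 0 →
    ∀ (K : Submodule ℂ (Fin n × Fin n → ℂ)) (k : ℕ),
      (∀ x v : Fin n × Fin n → ℂ, v ∈ K → (twist N x v) ^ (k + 1) = 0) →
        Ledger n m N (fun _ => True) K k

/-- **FIRST LEMMA (provider, flag form = RESOLVENT FLAG).**  If at every point `x` all `(k+1)`-fold products of twisted
directions vanish — equivalently the twisted space `R_{N(x)}(u)·lin K` lowers a chain of `ℂ(u)`-subspaces of length `k+1` —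
then `(K, k)` is a whole-pencil ledger for every `n`.  (Gauge row r4 on the cones `W(m)` is the half-twisted flag
`E_{>h} < R_A(u)E_{≥h} < ℂ(u)^m`, memo §3; flag floor r4′ concerns CONSTANT flags only.) -/
def LedgerOfResolventFlag : Prop :=
  ∀ (n m : ℕ) (N : AffMat n m), IsAffine N → N ^ m = 0 →
    ∀ (K : Submodule ℂ (Fin n × Fin n → ℂ)) (k : ℕ),
      (∀ x : Fin n × Fin n → ℂ, ∀ w : Fin (k + 1) → (Fin n × Fin n → ℂ), (∀ t, w t ∈ K) →
          (List.ofFn fun t => twist N x (w t)).prod = 0) →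
        Ledger n m N (fun _ => True) K k

/-- The flag form implies the index form's hypothesis (constant words), so it is the weaker provider. -/
theorem resolventFlag_hyp_of_const {n m : ℕ} (N : AffMat n m) (K : Submodule ℂ (Fin n × Fin n → ℂ)) (k : ℕ)
    (h : ∀ x : Fin n × Fin n → ℂ, ∀ w : Fin (k + 1) → (Fin n × Fin n → ℂ), (∀ t, w t ∈ K) →
      (List.ofFn fun t => twist N x (w t)).prod = 0)
    (x v : Fin n × Fin n → ℂ) (hv : v ∈ K) : (twist N x v) ^ (k + 1) = 0 := by
  have := h x (fun _ => v) (fun _ => hv)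
  rw [pow_succ']
  simpa [List.ofFn_const, List.prod_replicate] using this

/-- The index provider implies the flag provider. [val-idea-30 g7] -/
theorem ledgerOfResolventFlag_of_index (h : LedgerOfResolventIndex) : LedgerOfResolventFlag := by
  intro n m N hN hnil K k hw
  exact h n m N hN hnil K k (fun x v hv => resolventFlag_hyp_of_const N K k hw x v hv)

/-! ## §P (val-idea-30 g7) PROOF of the index provider `LedgerOfResolventIndex` — hence of `LedgerOfResolventFlag`

Finite polynomial-identity proof (no power series).  Over the `u`-polynomial ring `S[X]`, `S := MvPolynomial (Fin 1) ℂ`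
(the `s`-ring, `s = X 0`), with `A := N(x)`, `B := lin v`, `M := N(x + s v) = A + s·B`, `R_A := Σ_{a<m} u^a A^a`, `T := R_A·B`,
`σ := s` (a constant of `S[X]`):
* `(1 − uA)·R_A = 1` (geometric sum, `A^m = 0`);
* `T^{k+1} = 0 ⇒ (1 − σu·T)·G = 1` with `G := Σ_{d ≤ k} (σu·T)^d`;
* `1 − u·M = (1 − uA)(1 − σu·T)`, hence `(1 − uM)·(G·R_A) = 1`;
* `Σ_{j ≤ b} (uM)^j = G·R_A − (uM)^{b+1}·G·R_A` (geometric sum), and comparing the coefficients of `u^b` entrywise: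
  `(M^b)_{ij} = Σ_{d ≤ k, d ≤ b} s^d · [u^{b−d}] (T^d R_A)_{ij}` — an `s`-polynomial of degree `≤ k`, for EVERY exponent `b`.
-/

section Proof

open Polynomial (coeff)
open Summit.ValiantsHypothesis.ValiantsHypothesis.Theorems.GrenetZeon.RadicalSplit (lineSubst)
open Summit.ValiantsHypothesis.ValiantsHypothesis.Theorems.GrenetZeon.SlowCore (lineSubst_apply_of_le_one)

variable {n m : ℕ}

/-- The `s`-ring `ℂ[s]` of the ledger (`s = MvPolynomial.X 0`). -/
abbrev SRing : Type := MvPolynomial (Fin 1) ℂ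

/-- Transport `ℂ[u] → ℂ[s][u]` on matrices (coefficientwise `MvPolynomial.C`). -/
noncomputable def transport (m : ℕ) :
    Matrix (Fin m) (Fin m) ℂ[X] →+* Matrix (Fin m) (Fin m) (Polynomial SRing) :=
  (Polynomial.mapRingHom (MvPolynomial.C : ℂ →+* SRing)).mapMatrix

/-- A complex matrix as a matrix of constants of `ℂ[s][u]`. -/
noncomputable def cst (P : Matrix (Fin m) (Fin m) ℂ) : Matrix (Fin m) (Fin m) (Polynomial SRing) :=
  P.map fun a => Polynomial.C (MvPolynomial.C a : SRing)

/-- Entries of the transported matrix. [folklore] -/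
theorem transport_apply (Q : Matrix (Fin m) (Fin m) ℂ[X]) (i j : Fin m) :
    transport m Q i j = Polynomial.map (MvPolynomial.C : ℂ →+* SRing) (Q i j) := by
  simp [transport, RingHom.mapMatrix_apply, Matrix.map_apply]

/-- Transport of a constant matrix is the constant matrix. [folklore] -/
theorem transport_map_C (P : Matrix (Fin m) (Fin m) ℂ) :
    transport m (P.map Polynomial.C) = cst P := by
  refine Matrix.ext fun i j => ?_
  rw [transport_apply, Matrix.map_apply, Polynomial.map_C, cst, Matrix.map_apply]

/-- Transport commutes with `u^a •`. [folklore] -/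
theorem transport_X_pow_smul (a : ℕ) (Q : Matrix (Fin m) (Fin m) ℂ[X]) :
    transport m ((Polynomial.X : ℂ[X]) ^ a • Q) = (Polynomial.X : Polynomial SRing) ^ a • transport m Q := by
  refine Matrix.ext fun i j => ?_
  rw [transport_apply, Matrix.smul_apply, Matrix.smul_apply, smul_eq_mul, smul_eq_mul, Polynomial.map_mul,
    Polynomial.map_pow, Polynomial.map_X, transport_apply]

/-- `A^m = 0` for the point value `A = N(x)` of a pencil with `N^m = 0`. -/
theorem pointMat_pow_eq_zero (N : AffMat n m) (hnil : N ^ m = 0) (x : Fin n × Fin n → ℂ) :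
    (pointMat N x) ^ m = 0 := by
  rw [pointMat, ← Matrix.map_pow N (MvPolynomial.eval x : MvPolynomial (Fin n × Fin n) ℂ →+* ℂ) m]
  change (N ^ m).map (MvPolynomial.eval x) = 0
  simp [hnil]

/-- The resolvent is a geometric sum: `R_A = Σ_{a<m} (u·A)^a`. -/
theorem resolvent_eq_geom_sum (N : AffMat n m) (x : Fin n × Fin n → ℂ) :
    resolvent N x = ∑ a ∈ Finset.range m, ((Polynomial.X : ℂ[X]) • (pointMat N x).map Polynomial.C) ^ a := by
  refine Finset.sum_congr rfl fun a _ => ?_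
  rw [smul_pow, Matrix.map_pow (pointMat N x) (Polynomial.C : ℂ →+* ℂ[X]) a]

/-- `(1 − u·A)·R_A = 1` over `ℂ[u]`. -/
theorem one_sub_smul_mul_resolvent (N : AffMat n m) (hnil : N ^ m = 0) (x : Fin n × Fin n → ℂ) :
    (1 - (Polynomial.X : ℂ[X]) • (pointMat N x).map Polynomial.C) * resolvent N x = 1 := by
  rw [resolvent_eq_geom_sum, mul_neg_geom_sum, smul_pow,
    ← Matrix.map_pow (pointMat N x) (Polynomial.C : ℂ →+* ℂ[X]) m]
  change 1 - (Polynomial.X : ℂ[X]) ^ m • ((pointMat N x) ^ m).map Polynomial.C = 1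
  rw [pointMat_pow_eq_zero N hnil x]
  ext i j
  simp

/-- The substituted pencil as a `u`-constant: `M = A + σ·B` with `σ = s`. -/
theorem map_lineSubst_map_C (N : AffMat n m) (hN : IsAffine N) (x v : Fin n × Fin n → ℂ) :
    (N.map (lineSubst x v)).map (Polynomial.C : SRing → Polynomial SRing) =
      cst (pointMat N x) + Polynomial.C (MvPolynomial.X 0 : SRing) • cst (linMat N v) := by
  refine Matrix.ext fun i j => ?_
  rw [Matrix.map_apply, Matrix.map_apply, lineSubst_apply_of_le_one N hN x v i j, Matrix.add_apply,
    Matrix.smul_apply, smul_eq_mul, cst, cst, Matrix.map_apply, Matrix.map_apply, pointMat, linMat,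
    Matrix.map_apply, Matrix.of_apply, Polynomial.C_add, Polynomial.C_mul, mul_comm]

/-- `transport` commutes with the scalar `u`. -/
theorem transport_X_smul (Q : Matrix (Fin m) (Fin m) ℂ[X]) :
    transport m ((Polynomial.X : ℂ[X]) • Q) = (Polynomial.X : Polynomial SRing) • transport m Q := by
  simpa only [pow_one] using transport_X_pow_smul 1 Q

/-- **MAIN LEMMA.**  If the twisted direction `R_{N(x)}(u)·lin v` is nilpotent of index `≤ k+1` over `ℂ[u]`, then EVERY power of
`N(x + s v)` has entries of `s`-degree `≤ k` (all exponents `b`, no truncation). -/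
theorem totalDegree_pow_apply_le_of_twist_pow_eq_zero (N : AffMat n m) (hN : IsAffine N) (hnil : N ^ m = 0)
    (x v : Fin n × Fin n → ℂ) (k : ℕ) (hT : (twist N x v) ^ (k + 1) = 0) (b : ℕ) (i j : Fin m) :
    (((N.map (lineSubst x v)) ^ b) i j).totalDegree ≤ k := by
  classical
  -- everything is cast into matrices over `S[u]`, `S = ℂ[s]`
  set M : Matrix (Fin m) (Fin m) SRing := N.map (lineSubst x v) with hM
  set Mu : Matrix (Fin m) (Fin m) (Polynomial SRing) := M.map Polynomial.C with hMu
  set Au : Matrix (Fin m) (Fin m) (Polynomial SRing) := cst (pointMat N x) with hAu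
  set Bu : Matrix (Fin m) (Fin m) (Polynomial SRing) := cst (linMat N v) with hBu
  set RA : Matrix (Fin m) (Fin m) (Polynomial SRing) := transport m (resolvent N x) with hRA
  set T : Matrix (Fin m) (Fin m) (Polynomial SRing) := transport m (twist N x v) with hTdef
  set u : Polynomial SRing := Polynomial.X with hu
  set σ : Polynomial SRing := Polynomial.C (MvPolynomial.X 0 : SRing) with hσ
  -- (1) `(1 − uA) R_A = 1`
  have h1 : (1 - u • Au) * RA = 1 := by
    have h0 := congrArg (transport m) (one_sub_smul_mul_resolvent N hnil x)
    rw [map_mul, map_one, map_sub, map_one, transport_X_smul, transport_map_C, ← hu, ← hAu, ← hRA] at h0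
    exact h0
  -- (2) `T = R_A · B`, `T^{k+1} = 0`
  have hT' : T = RA * Bu := by
    rw [hTdef, twist, map_mul, transport_map_C, ← hRA, ← hBu]
  have hTk : T ^ (k + 1) = 0 := by
    rw [hTdef, ← map_pow, hT, map_zero]
  -- (3) `(1 − σu·T) G = 1`
  set G : Matrix (Fin m) (Fin m) (Polynomial SRing) := ∑ d ∈ Finset.range (k + 1), ((σ * u) • T) ^ d with hG
  have h3 : (1 - (σ * u) • T) * G = 1 := by
    rw [hG, mul_neg_geom_sum, smul_pow, hTk, smul_zero, sub_zero]
  -- (4) `M = A + σ B` and `1 − uM = (1 − uA)(1 − σu T)`, so `(1 − uM)(G R_A) = 1`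
  have hMu' : Mu = Au + σ • Bu := by
    rw [hMu, hM, hAu, hBu, hσ]
    exact map_lineSubst_map_C N hN x v
  have h4 : 1 - u • Mu = (1 - u • Au) * (1 - (σ * u) • T) := by
    rw [mul_sub, mul_one, Matrix.mul_smul, hT', ← Matrix.mul_assoc, h1, Matrix.one_mul, hMu', smul_add,
      ← mul_smul, mul_comm u σ]
    abel
  have h5 : (1 - u • Mu) * (G * RA) = 1 := by
    rw [h4, Matrix.mul_assoc, ← Matrix.mul_assoc _ G RA, h3, Matrix.one_mul, h1]
  -- (5) geometric sum for `uM`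
  have h6 : (∑ a ∈ Finset.range (b + 1), (u • Mu) ^ a) = G * RA - (u • Mu) ^ (b + 1) * (G * RA) := by
    have hgs : (∑ a ∈ Finset.range (b + 1), (u • Mu) ^ a) * (1 - u • Mu) = 1 - (u • Mu) ^ (b + 1) :=
      geom_sum_mul_neg _ _
    calc (∑ a ∈ Finset.range (b + 1), (u • Mu) ^ a)
        = (∑ a ∈ Finset.range (b + 1), (u • Mu) ^ a) * ((1 - u • Mu) * (G * RA)) := by
          rw [h5, Matrix.mul_one]
      _ = (1 - (u • Mu) ^ (b + 1)) * (G * RA) := by rw [← Matrix.mul_assoc, hgs]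
      _ = G * RA - (u • Mu) ^ (b + 1) * (G * RA) := by rw [sub_mul, Matrix.one_mul]
  -- (6) compare the `u^b` coefficients of the `(i,j)` entries
  have hcoef : coeff ((∑ a ∈ Finset.range (b + 1), (u • Mu) ^ a) i j) b =
      coeff ((G * RA - (u • Mu) ^ (b + 1) * (G * RA)) i j) b := by
    rw [h6]
  -- left side = `(M^b) i j`
  have hterm : ∀ a : ℕ, coeff (((u • Mu) ^ a) i j) b = if b = a then (M ^ a) i j else 0 := by
    intro a
    rw [smul_pow, Matrix.smul_apply, smul_eq_mul, hMu, ← Matrix.map_pow M (Polynomial.C : SRing →+* _) a]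
    change coeff (u ^ a * Polynomial.C ((M ^ a) i j)) b = _
    rw [mul_comm, hu, Polynomial.coeff_C_mul_X_pow]
  have hL : coeff ((∑ a ∈ Finset.range (b + 1), (u • Mu) ^ a) i j) b = (M ^ b) i j := by
    rw [Matrix.sum_apply, Polynomial.finsetSum_coeff,
      Finset.sum_eq_single_of_mem b (Finset.mem_range.2 (Nat.lt_succ_self b))
        (fun a _ hab => by rw [hterm a, if_neg (Ne.symm hab)]),
      hterm b, if_pos rfl]
  -- the tail term has no `u^b` coefficient
  have hR2 : coeff (((u • Mu) ^ (b + 1) * (G * RA)) i j) b = 0 := by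
    rw [smul_pow, Matrix.smul_mul, Matrix.smul_apply, smul_eq_mul, hu, Polynomial.coeff_X_pow_mul',
      if_neg (by omega)]
  -- the head term is an `s`-polynomial of degree `≤ k`
  have hR1 : coeff ((G * RA) i j) b = ∑ d ∈ Finset.range (k + 1),
      (if d ≤ b then (MvPolynomial.X 0 : SRing) ^ d *
        MvPolynomial.C (coeff (((twist N x v) ^ d * resolvent N x) i j) (b - d)) else 0) := by
    rw [hG, Finset.sum_mul, Matrix.sum_apply, Polynomial.finsetSum_coeff]
    refine Finset.sum_congr rfl fun d _ => ?_
    rw [smul_pow, Matrix.smul_mul, Matrix.smul_apply, smul_eq_mul, hTdef, hRA, ← map_pow, ← map_mul,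
      transport_apply, mul_pow, hσ, ← Polynomial.C_pow, mul_assoc, Polynomial.coeff_C_mul, hu,
      Polynomial.coeff_X_pow_mul']
    by_cases hdb : d ≤ b
    · rw [if_pos hdb, if_pos hdb, Polynomial.coeff_map]
    · rw [if_neg hdb, if_neg hdb, mul_zero]
  rw [hL, Matrix.sub_apply, Polynomial.coeff_sub, hR2, sub_zero, hR1] at hcoef
  rw [hcoef]
  refine (MvPolynomial.totalDegree_finsetSum _ _).trans (Finset.sup_le fun d hd => ?_)
  have hdk : d ≤ k := Nat.lt_succ_iff.1 (Finset.mem_range.1 hd)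
  by_cases hdb : d ≤ b
  · rw [if_pos hdb]
    refine (MvPolynomial.totalDegree_mul _ _).trans ?_
    rw [MvPolynomial.totalDegree_C, add_zero]
    exact (MvPolynomial.totalDegree_X_pow (R := ℂ) (0 : Fin 1) d).le.trans hdk
  · rw [if_neg hdb, MvPolynomial.totalDegree_zero]
    exact Nat.zero_le _

/-- ✓ **The index provider HOLDS**: twisted directions of nil-index `≤ k+1` over `ℂ[u]` give the whole-pencil ledger `(K, k)` for every `n`. -/
theorem ledgerOfResolventIndex_holds : LedgerOfResolventIndex := by
  intro n m N hN hnil K k hK x v hv b _ i j _ _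
  exact totalDegree_pow_apply_le_of_twist_pow_eq_zero N hN hnil x v k (hK x v hv) b i j

/-- ✓ **The flag provider HOLDS** (resolvent flags of length `k+1` certify the ledger `(K, k)` for every `n`). -/
theorem ledgerOfResolventFlag_holds : LedgerOfResolventFlag :=
  ledgerOfResolventFlag_of_index ledgerOfResolventIndex_holds

/-- ✓ **Pluggable form for (c)**: a resolvent-index certificate `(K, k)` — every twisted direction `R_{N(x)}(u)·lin v`, `v ∈ K`,
nilpotent of index `≤ k+1` over `ℂ[u]` — is a whole-pencil `RelCert` of PRICE `n·k + codim K` (for every `n`). -/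
theorem relCert_of_twist_pow_eq_zero {n m : ℕ} (N : AffMat n m) (hN : IsAffine N) (hnil : N ^ m = 0)
    (K : Submodule ℂ (Fin n × Fin n → ℂ)) (k : ℕ)
    (hK : ∀ x v : Fin n × Fin n → ℂ, v ∈ K → (twist N x v) ^ (k + 1) = 0) :
    RelCert n m N (n * k + (n * n - Module.finrank ℂ K)) :=
  ⟨K, k, ledgerOfResolventIndex_holds n m N hN hnil K k hK, le_rfl⟩

end Proof

end Summit.ValiantsHypothesis.ValiantsHypothesis.Theorems.GrenetZeon.ResolventFlag
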